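import Literature.NumberTheory.Automorphic.BCDTModularity
import Literature.NumberTheory.Automorphic.LanglandsTunnellModThree
import Literature.NumberTheory.Automorphic.CDTTheorem722
import Literature.NumberTheory.EllipticCurves.NewformGaloisRepModLAssembly
import HarnessLib

/-!
# `stub_modThree` — ideator k = 3, GENERATION 16 (home family 3: probe the extremes)
# "EXTREMES OF THE INTERFACE WEIGHT"

Typed companion of `STUB-IDEAS-stub_modThree-3.md` (gen 16).  Nothing here is registered; the
skeleton `Lines/Sketch.lean` (sha 21576c53) is untouched.  NO `sorry`: helper STATEMENTS are
`def … : Prop`, every `theorem` is proved.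

Gens 12–15 of this ideator froze the MATHEMATICS of the stub (`stub ⟺ F‴ ∧ CubeBranch`, F‴ =
Tunnell's octahedral case at full strength by Rubin's `X_ρ̄(3) ≅ ℙ¹`).  Gen 16 probes the one
parameter nobody had pushed to its extremes: the WEIGHT `w` hidden in the stub's conclusion
`ρ.IsModular := ∃ N w f …, 1 ≤ w ∧ IsNewform1 f ∧ …` (BCDTModularity L276), across the stub's two
producer cells and its one consumer (`hmod3` of `liftThree_of_stubs`, Sketch L526):

* minimal extreme `w = 1`: the octahedral cell — the tree's Langlands–Tunnell proof ends
  `refine ⟨N, hN, 1, f, …⟩` (LanglandsTunnellModThree L491): weight ONE, level `N(σ)` with `3 ∣ N(σ)`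
  always (`det σ` is ramified at `3`), nebentypus `ε` of order `2`;
* `w = 2`: the CM / 2-group cell — the tree's Shimura newform theorem
  `shimura1972_heckeTheta_isNewform0_of_primitive` is stated for `Γ₀`, weight `k ≥ 2`
  (CMNewformGamma0PrimitiveIsNewform L76–89): k1's bricks E0–E5 deliver weight TWO (type-`(1,0)`
  Größencharakter), trivial character, level `|d_K|·N𝔣`; weight one (finite-order `ψ`, `k = 1`) is
  NOT covered by any tree fact;
* the consumer wants weight TWO (Diamond CSS Cor. 6.2 / DDT Thm. 3.14(a): k1-liftThree g13–g15's
  socket input `IsModularWeightTwoCofinite`), and converting an arbitrary-weight witness to weight 2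
  at `ℓ = 3` (`IN1high 3`: Edixhoven §4.2–4.3, "a version of Carayol's lemma", CSS p. 298–299) is
  needed by NO producer.

Conclusion typed below: the interface both cells meet with S/M prover work only, and which removes
`IN1high 3` from the crux, is `IsModularWeightTwoCofinite` — Gelbart's own architecture (CSS §1.4,
Prop. 1.4 ends in weight two: Step 4 `E_{1,χ}`, Step 5 Deligne–Serre §6.10, p. 219).  The glue
`liftThree_of_stubsW2` has the registered shape verbatim; `sigStubModThreeW2_of_cells` is the
producer-side composition (oddness PROVED from the tree, LT weight-one slice, transfer package).
-/

noncomputable section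

open scoped MatrixGroups Matrix NumberField ModularForm Polynomial
open Literature.NumberTheory Literature.NumberTheory.Automorphic
open Literature.NumberTheory.GaloisRepresentations Literature.NumberTheory.GaloisRepresentations.ModPGaloisRep
open Literature.NumberTheory.EllipticCurves Literature.NumberTheory.EllipticCurves.ModularForms
open IsDedekindDomain CongruenceSubgroup

set_option linter.dupNamespace false

namespace Summit.ABC.ABC.Cruxes.FreyModularity.StubIdeasModThree3G16

/-! ## §0 The registered stub and the weight slices (k1 verbatim) -/

/-- The registered stub `stub_modThree`, verbatim (`Lines/Sketch.lean` L143). [cite: Wiles1995Annals, Ch. 5] -/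
def SigStubModThree : Prop :=
  ∀ (W : WeierstrassCurve ℚ) [W.IsElliptic] (ρ : ModPGaloisRep ℚ (ZMod 3) 2),
    W.IsTorsionGaloisRep 3 ρ → FramedRep.IsAbsolutelyIrreducible ρ → ρ.IsModular

/-- The weight-`w` slice of `ModPGaloisRep.IsModular` (k1-liftThree g14/g15, verbatim).
[cite: BCDTJAMS2001, Introduction] -/
def IsModularOfWeight {k : Type} [Field k] [TopologicalSpace k] [DiscreteTopology k] (w : ℤ)
    (ρ : ModPGaloisRep ℚ k 2) : Prop :=
  ∃ (N : ℕ) (_ : NeZero N) (f : CuspForm (Gamma1 N) w) (K : Type) (_ : Field K)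
    (_ : TopologicalSpace K) (_ : DiscreteTopology K) (j : k →+* K)
    (ι : coeffCharIntegers f →+* K),
    IsNewform1 f ∧
      IsGaloisRepOfNewform1Int f ι {q | q ∣ N * ringChar k}
        (FramedRep.baseChange j continuous_of_discreteTopology ρ)

/-- Weight-2 modularity with a COFINITE exceptional set (k1-liftThree g15 `IsModularWeightTwoCofinite`,
verbatim): the consumer-side input of the `R = T` socket at `3` (DDT Def. 3.12 + Thm. 3.1).
[cite: DarmonDiamondTaylor1995, Def. 3.12, Thm. 3.1] -/
def IsModularWeightTwoCofinite {k : Type} [Field k] [TopologicalSpace k] [DiscreteTopology k]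
    (ρ : ModPGaloisRep ℚ k 2) : Prop :=
  ∃ (N : ℕ) (_ : NeZero N) (g : CuspForm (Gamma1 N) 2) (K : Type) (_ : Field K)
    (_ : TopologicalSpace K) (_ : DiscreteTopology K) (j : k →+* K)
    (ι : coeffCharIntegers g →+* K) (S : Set ℕ),
    S.Finite ∧ {q | q ∣ N * ringChar k} ⊆ S ∧ IsNewform1 g ∧
      IsGaloisRepOfNewform1Int g ι S (FramedRep.baseChange j continuous_of_discreteTopology ρ)

/-- Any weight slice re-implies the registered any-weight conclusion (PROVED). [folklore] -/
theorem isModular_of_isModularOfWeight {k : Type} [Field k] [TopologicalSpace k]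
    [DiscreteTopology k] {w : ℤ} (hw : 1 ≤ w) (ρ : ModPGaloisRep ℚ k 2)
    (h : IsModularOfWeight w ρ) : ρ.IsModular := by
  obtain ⟨N, hN, f, K, hK, hT, hD, j, ι, hf, hatt⟩ := h
  exact ⟨N, hN, w, f, K, hK, hT, hD, j, ι, hw, hf, hatt⟩

/-- The exact-exceptional-set weight-2 slice gives the cofinite predicate (PROVED; the CM cell's
output lands here with `S = {q ∣ 3 · |d_K| · N𝔣}`). [folklore] -/
theorem isModularWeightTwoCofinite_of_weightTwo (ρ : ModPGaloisRep ℚ (ZMod 3) 2)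
    (h : IsModularOfWeight 2 ρ) : IsModularWeightTwoCofinite ρ := by
  obtain ⟨N, hN, g, K, hK, hT, hD, j, ι, hg, hatt⟩ := h
  refine ⟨N, hN, g, K, hK, hT, hD, j, ι, {q | q ∣ N * ringChar (ZMod 3)}, ?_, le_rfl, hg, hatt⟩
  have hne : N * ringChar (ZMod 3) ≠ 0 := by
    rw [ZMod.ringChar_zmod_n]
    exact mul_ne_zero (NeZero.ne N) (by norm_num)
  exact (Set.finite_Iic (N * ringChar (ZMod 3))).subset fun q hq ↦ Nat.le_of_dvd
    (Nat.pos_of_ne_zero hne) hq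

/-! ## §1 The two extremes of `w`, typed -/

/-- **Minimal extreme (`w = 1`) = the octahedral cell's native output.**  LTW1 (k1-liftThree g15
`LTWeightOne`, conclusion): every odd absolutely irreducible `ρ̄ : Γ_ℚ → GL₂(𝔽₃)` is modular OF
WEIGHT ONE.  Size S as a clone of `isModular_of_isAbsolutelyIrreducible_of_isOdd_of_langlands_tunnell`
(its tuple is `⟨N, hN, 1, f, …⟩`), FROZEN on the Langlands–Tunnell leaves exactly like F‴.
[cite: Gelbart1997, §1.4 Prop. 1.4, Steps 1–3] -/
def LTW1 : Prop :=
  ∀ ρ : ModPGaloisRep ℚ (ZMod 3) 2, FramedRep.IsAbsolutelyIrreducible ρ →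
    FramedGaloisRep.IsOdd ρ → IsModularOfWeight 1 ρ

/-- **The producer-side transfer `w = 1 ↦ w = 2` at `ℓ = 3` (Gelbart Steps 4–5: `g · E_{1,χ₃} ≡ g`,
Deligne–Serre §6.10), packaged**: a weight-one witness gives a weight-two COFINITE witness.  It is the
conjunction of k1-liftThree's typed pieces H1 (`E13` multiplier, S), H3″
(`WeightTwoNewformCongrThreeIdeal`, M) and H4a (`AttachCofinite`, S: the Hecke polynomials agree mod `v`
because `χ₃(p) p ≡ 1 (mod 3)`), none of which consumes a named fact.
[cite: Gelbart1997, §1.4 Steps 4–5 (CSS p. 219)] [cite: DeligneSerre1974, §6.10] -/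
def TransferW1W2 : Prop :=
  ∀ ρ : ModPGaloisRep ℚ (ZMod 3) 2, IsModularOfWeight 1 ρ → IsModularWeightTwoCofinite ρ

/-- Oddness of every framed model of `E[3]` (PROVED, tree: Weil pairing `det ρ̄ = χ̄₃`).
[cite: SilvermanCSS1997, §7] -/
theorem isOdd_of_isTorsionGaloisRep_three (W : WeierstrassCurve ℚ) [W.IsElliptic]
    (ρ : ModPGaloisRep ℚ (ZMod 3) 2) (hρ : W.IsTorsionGaloisRep 3 ρ) : FramedGaloisRep.IsOdd ρ := by
  haveI : NeZero ((3 : ℕ) : ℚ) := ⟨by norm_num⟩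
  intro φ c hc
  rw [W.det_eq_modPCyclotomicCharacter_of_isTorsionGaloisRep_holds 3 ρ hρ c]
  ext
  rw [modPCyclotomicCharacterZMod_eq_modNCyclotomicCharacter,
    modNCyclotomicCharacter_of_isComplexConjugation hc, Units.val_neg, Units.val_one]

/-! ## §2 The W2-typed stub, its cells, and the glue (all compositions PROVED) -/

/-- **The stub at the W2 interface** (recommended re-typing for the lead's final-cycle re-cut; NOT
registered): same hypotheses, conclusion `IsModularWeightTwoCofinite ρ`. [cite: Gelbart1997, §1.4 Prop. 1.4] -/
def SigStubModThreeW2 : Prop :=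
  ∀ (W : WeierstrassCurve ℚ) [W.IsElliptic] (ρ : ModPGaloisRep ℚ (ZMod 3) 2),
    W.IsTorsionGaloisRep 3 ρ → FramedRep.IsAbsolutelyIrreducible ρ → IsModularWeightTwoCofinite ρ

/-- The octahedral (surjective) cell at the W2 interface = F‴ with the transfer folded in.
[cite: Tunnell1981, Theorem] -/
def SigStubModThreeSurjW2 : Prop :=
  ∀ (W : WeierstrassCurve ℚ) [W.IsElliptic] (ρ : ModPGaloisRep ℚ (ZMod 3) 2),
    W.IsTorsionGaloisRep 3 ρ → Function.Surjective ρ → IsModularWeightTwoCofinite ρ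

/-- The CM / 2-group cell at the W2 interface (k1's bricks E0–E5 end in a weight-2 `Γ₀` newform, so
they land here through `isModularWeightTwoCofinite_of_weightTwo`). [cite: Shimura1972Nagoya, Thm. 1] -/
def SigStubModThreeTwoGroupW2 : Prop :=
  ∀ (W : WeierstrassCurve ℚ) [W.IsElliptic] (ρ : ModPGaloisRep ℚ (ZMod 3) 2),
    W.IsTorsionGaloisRep 3 ρ → FramedRep.IsAbsolutelyIrreducible ρ →
    IsPGroup 2 ρ.toMonoidHom.range → IsModularWeightTwoCofinite ρ

/-- **Producer-side composition (PROVED):** oddness (tree) + LT weight-one slice + the transfer give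
the W2-typed stub for EVERY absolutely irreducible framed `E[3]` — the CM cell is not even needed on
this road (Langlands–Tunnell covers the 2-group images too); it matters only if LTW1 is restricted to
surjective `ρ̄`. [cite: Gelbart1997, §1.4 Prop. 1.4] -/
theorem sigStubModThreeW2_of_cells (hLT1 : LTW1) (hT : TransferW1W2) : SigStubModThreeW2 :=
  fun W _ ρ hρ habs ↦ hT ρ (hLT1 ρ habs (isOdd_of_isTorsionGaloisRep_three W ρ hρ))

/-- The image dichotomy brick (k1 N1 / k3-g14 boundary, PROVED there from Serre 1972 Prop. 15 and
`|GL₂(𝔽₃)| = 48`; quoted here as a hypothesis shape). [cite: Serre1972, §2.6 Prop. 15] -/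
def SurjOrTwoGroup : Prop :=
  ∀ (W : WeierstrassCurve ℚ) [W.IsElliptic] (ρ : ModPGaloisRep ℚ (ZMod 3) 2),
    W.IsTorsionGaloisRep 3 ρ → FramedRep.IsAbsolutelyIrreducible ρ →
    Function.Surjective ρ ∨ IsPGroup 2 ρ.toMonoidHom.range

/-- **Cell dispatch at the W2 interface (PROVED):** surjective cell + 2-group cell + dichotomy.
[folklore] -/
theorem sigStubModThreeW2_of_split (hN1 : SurjOrTwoGroup) (hS : SigStubModThreeSurjW2)
    (hC : SigStubModThreeTwoGroupW2) : SigStubModThreeW2 := fun W _ ρ hρ habs ↦ by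
  rcases hN1 W ρ hρ habs with h | h
  · exact hS W ρ hρ h
  · exact hC W ρ hρ habs h

/-- The consumer re-typed at W2 (k1-liftThree g15's socket shape `DiamondCSS62ᶜ 3 → …`; NOT registered).
[cite: Diamond1996, Thm. 5.4] -/
def SigLiftThreeW2 : Prop :=
  ∀ (W : WeierstrassCurve ℚ) [W.IsElliptic] (ρ : ModPGaloisRep ℚ (ZMod 3) 2),
    W.IsTorsionGaloisRep 3 ρ → ρ.IsAbsIrreducibleOverSqrt (-3) → ¬ 9 ∣ W.conductorNorm ℤ →
    IsModularWeightTwoCofinite ρ → W.IsModularGaloisRepTate 3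

/-- **The glue `liftThree_of_stubs` at the W2 interface (PROVED; the registered shape verbatim with
`ρ.IsModular ↦ IsModularWeightTwoCofinite ρ` in `hmod3`/`hlift3`)** — so the re-cut changes two stub
signatures and NO line of `FreyModularity_of`. [cite: ConradDiamondTaylor1999, Thm. 7.2.1 (proof, p. 553)] -/
theorem liftThree_of_stubsW2 (hmod3 : SigStubModThreeW2) (hlift3 : SigLiftThreeW2)
    (h32 : ∀ (W : WeierstrassCurve ℚ) [W.IsElliptic] [NeZero (W.conductorNorm ℤ)] (ℓ : ℕ)
      [Fact ℓ.Prime], W.IsModularGaloisRepTate ℓ → BCDT.IsModular W) :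
    ∀ (W : WeierstrassCurve ℚ) [W.IsElliptic] [NeZero (W.conductorNorm ℤ)]
      (ρ : ModPGaloisRep ℚ (ZMod 3) 2), W.IsTorsionGaloisRep 3 ρ →
      ρ.IsAbsIrreducibleOverSqrt (-3) → ¬ 9 ∣ W.conductorNorm ℤ → BCDT.IsModular W :=
  fun W _ _ ρ hρ hirr h9 ↦
    h32 W 3 (hlift3 W ρ hρ hirr h9 (hmod3 W ρ hρ hirr.isAbsolutelyIrreducible))

/-! ## §2b Bonus of the cyclotomic determinant: the octahedral lift lands on `Γ₀` -/

/-- **`Γ₀`-flavoured W2 interface at `ℓ = 3`** (uniform with liftFive k2-g14's `ArisesFromGammaZeroTwo`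
at `ℓ = 5`, up to exact-vs-cofinite `S`).  Trivial nebentypus is AVAILABLE on the octahedral cell: the
weight-one newform of `σ = Ψ ∘ ρ̄` has character `ε_f = det σ = (−3/·) = χ₃` (`GL₂(𝔽₃) ⊄ SL₂(ℂ)`, so
`det Ψ` is the determinant character, and `det ρ̄ = χ̄₃`), and Gelbart's multiplier `E_{1,χ₃}` carries
`χ₃`, so `f · E_{1,χ₃} ∈ S₂(Γ₀(3N(σ)))` has character `χ₃² = 1`; the CM cell is on `Γ₀` natively.
[cite: Gelbart1997, §1.4 Step 4 (CSS p. 219)] -/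
def IsModularWeightTwoGammaZeroCofinite (ρ : ModPGaloisRep ℚ (ZMod 3) 2) : Prop :=
  ∃ (N : ℕ) (_ : NeZero N) (g : CuspForm (Gamma1 N) 2) (K : Type) (_ : Field K)
    (_ : TopologicalSpace K) (_ : DiscreteTopology K) (j : ZMod 3 →+* K)
    (ι : coeffCharIntegers g →+* K) (S : Set ℕ),
    S.Finite ∧ {q | q ∣ N * ringChar (ZMod 3)} ⊆ S ∧ IsNewform1 g ∧ nebentypus g = 1 ∧
      IsGaloisRepOfNewform1Int g ι S (FramedRep.baseChange j continuous_of_discreteTopology ρ)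

/-- Forgetting the character recovers the W2 interface (PROVED). [folklore] -/
theorem isModularWeightTwoCofinite_of_gammaZero (ρ : ModPGaloisRep ℚ (ZMod 3) 2)
    (h : IsModularWeightTwoGammaZeroCofinite ρ) : IsModularWeightTwoCofinite ρ := by
  obtain ⟨N, hN, g, K, hK, hT, hD, j, ι, S, hS, hsub, hg, -, hatt⟩ := h
  exact ⟨N, hN, g, K, hK, hT, hD, j, ι, S, hS, hsub, hg, hatt⟩

/-- The transfer with the character bonus (the shape k1's H1 + H3″ + H4a actually deliver when
`ε_f = χ₃`: the nebentypus bookkeeping `c` of H3″ collapses to `c = 1`). [cite: DeligneSerre1974, §6.10] -/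
def TransferW1W2GammaZero : Prop :=
  ∀ ρ : ModPGaloisRep ℚ (ZMod 3) 2, FramedGaloisRep.IsOdd ρ → IsModularOfWeight 1 ρ →
    IsModularWeightTwoGammaZeroCofinite ρ

/-- (PROVED) the `Γ₀` transfer implies the plain one on odd `ρ̄`, hence feeds `sigStubModThreeW2_of_cells`
through oddness of `E[3]`. [folklore] -/
theorem sigStubModThreeW2_of_cells_gammaZero (hLT1 : LTW1) (hT : TransferW1W2GammaZero) :
    SigStubModThreeW2 := fun W _ ρ hρ habs ↦
  isModularWeightTwoCofinite_of_gammaZero ρ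
    (hT ρ (isOdd_of_isTorsionGaloisRep_three W ρ hρ)
      (hLT1 ρ habs (isOdd_of_isTorsionGaloisRep_three W ρ hρ)))

/-! ## §3 The two rejected extremes, typed as the obligations they would create -/

/-- **Weight-ONE interface (rejected):** would need the CM cell in weight one — theta series of a
FINITE-ORDER character of an imaginary quadratic field as a `Γ₁` newform (Hecke 1926 / the `k = 1`
case excluded by the tree's Shimura fact, `2 ≤ k`).  Typed only to name the missing carrier.
[cite: Shimura1972Nagoya, Thm. 1] -/
def CMWeightOneNewform : Prop :=
  ∀ (W : WeierstrassCurve ℚ) [W.IsElliptic] (ρ : ModPGaloisRep ℚ (ZMod 3) 2),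
    W.IsTorsionGaloisRep 3 ρ → FramedRep.IsAbsolutelyIrreducible ρ →
    IsPGroup 2 ρ.toMonoidHom.range → IsModularOfWeight 1 ρ

/-- **Any-weight interface (status quo):** the consumer must then convert weight `w ≥ 3` witnesses
(`IN1high 3`, Edixhoven §4.2–4.3 / Carayol at `ℓ = 3`) although no producer emits one — or ignore
`hmod` and re-derive weight one from Langlands–Tunnell (k1-liftThree T1), which makes `stub_modThree`
REDUNDANT in `FreyModularity_of`.  Typed as the conversion it would owe. [cite: Edixhoven1992, Thm. 4.5] -/
def IN1highShape : Prop :=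
  ∀ ρ : ModPGaloisRep ℚ (ZMod 3) 2, FramedRep.IsAbsolutelyIrreducible ρ → ρ.IsModular →
    IsModularWeightTwoCofinite ρ

/-- Sanity (PROVED): with the any-weight conversion in hand the registered stub implies the W2 stub —
i.e. `IN1highShape` is EXACTLY the price of keeping the registered conclusion. [folklore] -/
theorem sigStubModThreeW2_of_registered (h : SigStubModThree) (hconv : IN1highShape) :
    SigStubModThreeW2 := fun W _ ρ hρ habs ↦ hconv ρ habs (h W ρ hρ habs)

end Summit.ABC.ABC.Cruxes.FreyModularity.StubIdeasModThree3G16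

end
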